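import Literature.MathematicalPhysics.QuantumLattice.InfVolFermionStateLatticeMapPullback
import HarnessLib

/-!
# The checkerboard map `(u,v) ↦ (u+v, u−v)`: nearest-neighbour bonds become diagonal bonds, so every
# certified nearest-neighbour floor of the square-lattice Hubbard model is a floor for the model with
# ONLY diagonal hopping — the `t = 0` plane of the `(t, t', U)` coupling space as certified anchors

Topic `Literature/MathematicalPhysics/QuantumLattice` (family `hubbard`). Companion of
`InfVolFermionStateLatticeMapPullback.lean` (pullback `ω ∘ Γ_f` of infinite-volume states along an injective
lattice map, `InfVolFermionState.mapAct`; the doubling map and the kinematic `K₃` row) and of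
`HubbardTTPrimeBoxTransport.lean` (the CONIC TRANSPORT lemma `energyDensityTT'_ge_sum_conic`: floors
`lo_i ≤ e(t_i, t'_i, U_i, n)` at anchors with nonnegative weights `c_i` give
`Σ c_i lo_i ≤ e(Σ c_i t_i, Σ c_i t'_i, Σ c_i U_i, n)`). Written for stage S2 of the Hubbard material-oracle
programme, item «Untried (2): the `t = 0` PLANE AS ANCHORS» of the box-p3 census: the only `t = 0` anchors
available to the conic lemma were the free-fermion ones (`−16|t'|/π²`, no `U`-content); here every
certified `t' = 0` row `lo ≤ e(s, 0, U, n)` becomes the anchor `lo ≤ e(0, s, U, n)` on the `t = 0` plane WITH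
its `U`-content.

* §1 the checkerboard (45° rotation–dilation) map `cb (u, v) = (u + v, u − v)` of `ℤ²` onto the even
  sublattice: additive, injective, `cb e_i = e₁ ± e₂` (`checkerboard_unitVec`), `cb [-1,1]² ⊆ [-2,2]²`.
* §2 THE CHECKERBOARD BOND IDENTITY: `Γ_cb` carries the range-`1` mean-energy observable of `Φ(s, 0, U)`
  (nearest-neighbour hopping `s`, repulsion `U`) onto (the range-`2` embedding of) that of `Φ(0, s, U)`
  (`fermionEmbed_mapEmb_meanEnergyObs_checkerboard`): bond by bond (`fermionEmbed_hubbard_pair_eq_diag_pair`)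
  and the on-site term onto itself; hence `e_{Φ(s,0,U)}(ω ∘ Γ_cb) = e_{Φ(0,s,U)}(ω)` for every state
  (`meanEnergy_mapAct_checkerboard`).
* §3 `energyDensityTT'_nn_le_diag`: for `U ≥ 0`, `0 < ρ < 2` and every real `s`,
  `energyDensityTT' s 0 U ρ ≤ energyDensityTT' 0 s U ρ` — the pulled-back states of the
  translation-invariant states of filling `ρ` are translation invariant of filling `ρ`
  (`IsTranslationInvariant.mapAct`, `density_mapAct`), so the variational principle at `(s, 0, U)` bounds
  the diagonal-only mean energy of every competitor from below.

Everything is PROVED; the one definition (`checkerboard`, an `AddMonoidHom`) has a body; no named fact, no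
number, no `sorry`. HONEST SCOPE: the REVERSE inequality (the diagonal-only model is two decoupled copies of
the nearest-neighbour model, so equality holds) is NOT proved here — only the floor direction, which is
what the conic transport consumes; nothing here bears on order / pairing words.

## Mathlib / tree search

Tree (REUSED): `InfVolFermionState.mapAct/_expect`, `IsTranslationInvariant.mapAct`, `density_mapAct`,
`PolySite.mapEmb/_pt/ofLex_coe_pt`, `fermionEmbed_cAt_of_apply_eq`, `mem_thicken_zero_iff`, `mapSet`,
`hubbardFermionInteraction_meanEnergyObs/_apply_pair/_apply_singleton`, `diagHoppingFermionInteraction_meanEnergyObs/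
_apply_pair/_smul`, `hubbardTTPrimeFermionInteraction_meanEnergyObs`, `FermionInteraction.meanEnergyObs_of_smul`,
`diagVec`, `tiGroundEnergyDensityAt_hubbardTTPrime_eq_energyDensityTT'`, `le_tiGroundEnergyDensityAt`,
`exists_isTranslationInvariant_density_eq`, `energyDensityTT'_le_meanEnergy_of_isTranslationInvariant`.
`lean search 'checkerboard|sublattice.*energyDensityTT|energyDensityTT.*diag.*le'`: the free-fermion
`neg_sixteen_mul_abs_div_pi_sq_le_energyDensityTT'_diag` only.

## References

* O. Bratteli, D. W. Robinson, *OAQSM 1* (1987), §4.3.1 (states composed with morphisms of the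
  quasi-local algebra). [cite: BratteliRobinsonI1987, §4.3.1]
* H. Xu et al., Science 384 (2024) eadh7691, eq. (1) (the `t–t'` Hubbard Hamiltonian).
  [cite: XuEtAl2024, eq. (1)]
* D. Ruelle, *Statistical Mechanics* (1969), §3.4 (variational characterisation of the energy density).
  [cite: Ruelle1969, §3.4]
-/

noncomputable section

namespace Literature.MathematicalPhysics.QuantumLattice

open Matrix Finset HubbardWave0 Literature.Probability.LatticeModels ThermodynamicLimit
open _root_.Filter
open scoped _root_.Topology ComplexOrder BigOperators

/-- `Γ(φ) n_{xσ} = n_{yσ}` whenever `φ` sends the ordered site of `x` to (the ordered site of) `y`.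
[cite: ArakiMoriya2003, §4.1] -/
theorem fermionEmbed_nAt_of_apply_eq {d d' : ℕ} {Λ : Finset (Site d)} {Λ' : Finset (Site d')}
    (φ : PolySite Λ ↪ PolySite Λ') {x : Site d} (hx : x ∈ Λ) {y : Site d'} (hy : y ∈ Λ')
    (h : ofLex (φ (PolySite.pt x hx)).1 = y) (σ : Fin 2) :
    fermionEmbed φ (nAt x hx σ) = nAt y hy σ := by
  have h' : φ (PolySite.pt x hx) = PolySite.pt y hy :=
    Subtype.ext (by rw [← toLex_ofLex (φ _).1, h]; rfl)
  rw [nAt, fermionEmbed_numberOp, h']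

/-! ### §1–§3. The checkerboard map, the bond identity, the floor transfer -/

section Checkerboard

/-- **The checkerboard (45° rotation-dilation) map** `(u, v) ↦ (u + v, u − v)` of `ℤ²` onto the even
sublattice: additive, injective, and it carries the unit steps `e₁, e₂` onto the diagonal steps
`e₁ + e₂`, `e₁ − e₂`. [cite: XuEtAl2024, eq. (1)] -/
def checkerboard : Site 2 →+ Site 2 where
  toFun x := fun j => if j = 0 then x 0 + x 1 else x 0 - x 1
  map_zero' := by funext j; simp
  map_add' x y := by
    funext j
    by_cases hj : j = 0
    · simp only [hj, if_true, Pi.add_apply]; ring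
    · simp only [hj, if_false, Pi.add_apply]; ring

/-- Coordinates of the checkerboard map. [cite: XuEtAl2024, eq. (1)] -/
theorem checkerboard_apply (x : Site 2) (j : Fin 2) :
    checkerboard x j = if j = 0 then x 0 + x 1 else x 0 - x 1 := rfl

/-- The checkerboard map is injective. [cite: XuEtAl2024, eq. (1)] -/
theorem checkerboard_injective : Function.Injective checkerboard := by
  intro x y h
  have h0 := congrFun h 0
  have h1 := congrFun h 1
  simp only [checkerboard_apply, if_true, Fin.one_eq_zero_iff, OfNat.ofNat_ne_one, if_false] at h0 h1
  funext j
  fin_cases j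
  · change x 0 = y 0; omega
  · change x 1 = y 1; omega

/-- `e_i ↦ e₁ ± e₂`: the checkerboard map carries the unit steps onto the diagonal steps.
[cite: XuEtAl2024, eq. (1)] -/
theorem checkerboard_unitVec (i : Fin 2) : checkerboard (unitVec i) = diagVec i := by
  funext j
  rw [checkerboard_apply]
  fin_cases i <;> fin_cases j <;> simp [diagVec]

/-- The checkerboard map carries `[-1,1]²` into `[-2,2]²`. [cite: FriedliVelenik2017, §3.2] -/
theorem mapSet_checkerboard_thicken_one_subset :
    mapSet checkerboard (thicken ({0} : Finset (Site 2)) 1) ⊆ thicken ({0} : Finset (Site 2)) 2 := by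
  intro y hy
  obtain ⟨x, hx, rfl⟩ := (mem_mapSet_iff _).1 hy
  rw [mem_thicken_zero_iff, Nat.floor_one] at hx
  rw [mem_thicken_zero_iff, Nat.floor_ofNat]
  intro j
  have h0 := hx 0
  have h1 := hx 1
  rw [checkerboard_apply]
  push_cast at h0 h1 ⊢
  split_ifs <;> omega

/-- **A nearest-neighbour bond term is carried onto a diagonal bond term** by every ordered-site
embedding that sends `x ↦ y`, `x + e_i ↦ y + (e₁ ± e₂)` (same amplitude). [cite: XuEtAl2024, eq. (1)] -/
theorem fermionEmbed_hubbard_pair_eq_diag_pair (t U : ℝ) {Λ' : Finset (Site 2)} (x : Site 2) (i : Fin 2)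
    (φ : PolySite ({x, x + unitVec i} : Finset (Site 2)) ↪ PolySite Λ') (y : Site 2)
    (ψ : PolySite ({y, y + diagVec i} : Finset (Site 2)) ↪ PolySite Λ')
    (hx : ofLex (φ (PolySite.pt x (mem_insert_self _ _))).1 = ofLex (ψ (PolySite.pt y (mem_insert_self _ _))).1)
    (hxi : ofLex (φ (PolySite.pt (x + unitVec i) (mem_insert_of_mem (mem_singleton_self _)))).1 =
      ofLex (ψ (PolySite.pt (y + diagVec i) (mem_insert_of_mem (mem_singleton_self _)))).1) :
    fermionEmbed φ ((hubbardFermionInteraction 2 t U).Φ {x, x + unitVec i}) =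
      fermionEmbed ψ ((diagHoppingFermionInteraction t).Φ {y, y + diagVec i}) := by
  replace hx : φ (PolySite.pt x (mem_insert_self _ _)) = ψ (PolySite.pt y (mem_insert_self _ _)) :=
    Subtype.ext (by rw [← toLex_ofLex (φ _).1, hx, toLex_ofLex])
  replace hxi : φ (PolySite.pt (x + unitVec i) (mem_insert_of_mem (mem_singleton_self _))) =
      ψ (PolySite.pt (y + diagVec i) (mem_insert_of_mem (mem_singleton_self _))) :=
    Subtype.ext (by rw [← toLex_ofLex (φ _).1, hxi, toLex_ofLex])
  rw [hubbardFermionInteraction_apply_pair, diagHoppingFermionInteraction_apply_pair, map_smul,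
    map_smul, map_sum, map_sum]
  refine congrArg _ (Finset.sum_congr rfl fun σ _ => ?_)
  rw [map_add, map_add, map_mul, map_mul, map_mul, map_mul, fermionEmbed_conjTranspose,
    fermionEmbed_conjTranspose, fermionEmbed_conjTranspose, fermionEmbed_conjTranspose,
    fermionEmbed_cAt_of_apply_eq φ _ (PolySite.ofLex_mem _) (by rw [hx, PolySite.pt_ofLex]) σ,
    fermionEmbed_cAt_of_apply_eq φ _ (PolySite.ofLex_mem _) (by rw [hxi, PolySite.pt_ofLex]) σ,
    fermionEmbed_cAt_of_apply_eq ψ _ (PolySite.ofLex_mem _) (PolySite.pt_ofLex _).symm σ,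
    fermionEmbed_cAt_of_apply_eq ψ _ (PolySite.ofLex_mem _) (PolySite.pt_ofLex _).symm σ]

/-- The mean-energy observable of `Φ(0, s, U)` at range `1`: the on-site term at the origin plus the
four half diagonal bonds through the origin (the `t = 0` nearest-neighbour bond terms vanish).
[cite: XuEtAl2024, eq. (1)] -/
theorem meanEnergyObs_hubbardTTPrime_zero_t (s U : ℝ) :
    (hubbardTTPrimeFermionInteraction 0 s U).meanEnergyObs 1 =
      fermionEmbed (PolySite.incl (singleton_subset_iff.2 (zero_mem_thicken_zero 1)))
          ((hubbardFermionInteraction 2 0 U).Φ {0}) +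
        ∑ i : Fin 2,
          ((2 : ℂ)⁻¹ • fermionEmbed (PolySite.incl (pair_diagVec_subset_thicken_one i))
              ((diagHoppingFermionInteraction s).Φ {0, 0 + diagVec i}) +
            (2 : ℂ)⁻¹ • fermionEmbed (PolySite.incl (pair_neg_diagVec_subset_thicken_one i))
              ((diagHoppingFermionInteraction s).Φ {-diagVec i, -diagVec i + diagVec i})) := by
  have hnn : ∀ (x : Site 2) (i : Fin 2), (hubbardFermionInteraction 2 0 U).Φ {x, x + unitVec i} = 0 := by
    intro x i
    rw [hubbardFermionInteraction_apply_pair, Complex.ofReal_zero, neg_zero, zero_smul]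
  rw [hubbardTTPrimeFermionInteraction_meanEnergyObs, hubbardFermionInteraction_meanEnergyObs,
    diagHoppingFermionInteraction_meanEnergyObs]
  simp only [hnn, map_zero, smul_zero, add_zero, Finset.sum_const_zero]

/-- **THE CHECKERBOARD BOND IDENTITY.** `Γ` of the checkerboard map carries the range-`1` mean-energy
observable of `Φ(s, 0, U)` (nearest-neighbour hopping `s`, repulsion `U`) onto the range-`2` embedding of
that of `Φ(0, s, U)` (diagonal hopping `s`, repulsion `U`). [cite: XuEtAl2024, eq. (1)] -/
theorem fermionEmbed_mapEmb_meanEnergyObs_checkerboard (s U : ℝ) :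
    fermionEmbed (PolySite.incl mapSet_checkerboard_thicken_one_subset)
        (fermionEmbed (PolySite.mapEmb checkerboard checkerboard_injective (thicken ({0} : Finset (Site 2)) 1))
          ((hubbardTTPrimeFermionInteraction s 0 U).meanEnergyObs 1)) =
      fermionEmbed (PolySite.incl (thicken_mono ({0} : Finset (Site 2)) (by norm_num : (1 : ℝ) ≤ 2)))
        ((hubbardTTPrimeFermionInteraction 0 s U).meanEnergyObs 1) := by
  have hdiag : (diagHoppingFermionInteraction 0).meanEnergyObs 1 = 0 := by
    have h : ∀ X, (diagHoppingFermionInteraction 0).Φ X = (0 : ℂ) • (diagHoppingFermionInteraction 1).Φ X := by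
      intro X
      have h1 := diagHoppingFermionInteraction_smul 0 1 X
      rwa [zero_mul, Complex.ofReal_zero] at h1
    rw [FermionInteraction.meanEnergyObs_of_smul h, zero_smul]
  rw [hubbardTTPrimeFermionInteraction_meanEnergyObs s 0 U, hdiag, add_zero, hubbardFermionInteraction_meanEnergyObs,
    meanEnergyObs_hubbardTTPrime_zero_t, map_add, map_add, map_add, map_sum, map_sum, map_sum]
  refine congrArg₂ (· + ·) ?_ (Finset.sum_congr rfl fun i _ => ?_)
  · -- the on-site term `U n_{0↑} n_{0↓}` is carried onto itself (`cb 0 = 0`)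
    simp only [fermionEmbed_fermionEmbed, hubbardFermionInteraction_apply_singleton, map_smul, map_mul]
    have h0T : (0 : Site 2) ∈ thicken ({0} : Finset (Site 2)) 2 := zero_mem_thicken_zero 2
    rw [fermionEmbed_nAt_of_apply_eq _ (mem_singleton_self 0) h0T (by simp) 0,
      fermionEmbed_nAt_of_apply_eq _ (mem_singleton_self 0) h0T (by simp) 1,
      fermionEmbed_nAt_of_apply_eq _ (mem_singleton_self 0) h0T (by simp) 0,
      fermionEmbed_nAt_of_apply_eq _ (mem_singleton_self 0) h0T (by simp) 1]
  · simp only [map_add, map_smul, fermionEmbed_fermionEmbed]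
    refine congrArg₂ (· + ·) (congrArg _ ?_) (congrArg _ ?_)
    · refine fermionEmbed_hubbard_pair_eq_diag_pair s U 0 i _ 0 _ ?_ ?_
      · simp only [Function.Embedding.trans_apply, PolySite.incl_pt, PolySite.mapEmb_pt,
          PolySite.ofLex_coe_pt, map_zero]
      · simp only [Function.Embedding.trans_apply, PolySite.incl_pt, PolySite.mapEmb_pt,
          PolySite.ofLex_coe_pt, zero_add, checkerboard_unitVec]
    · refine fermionEmbed_hubbard_pair_eq_diag_pair s U (-unitVec i) i _ (-diagVec i) _ ?_ ?_
      · simp only [Function.Embedding.trans_apply, PolySite.incl_pt, PolySite.mapEmb_pt,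
          PolySite.ofLex_coe_pt, map_neg, checkerboard_unitVec]
      · simp only [Function.Embedding.trans_apply, PolySite.incl_pt, PolySite.mapEmb_pt,
          PolySite.ofLex_coe_pt, neg_add_cancel, map_zero]

/-- **`e_{Φ(s,0,U)}(ω ∘ Γ_cb) = e_{Φ(0,s,U)}(ω)`**: the mean energy of the pulled-back state for the
nearest-neighbour model is the mean energy of `ω` for the diagonal-only model (same hopping and
repulsion). [cite: XuEtAl2024, eq. (1)] -/
theorem InfVolFermionState.meanEnergy_mapAct_checkerboard (ω : InfVolFermionState 2) (s U : ℝ) :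
    (ω.mapAct checkerboard checkerboard_injective).meanEnergy (hubbardTTPrimeFermionInteraction s 0 U) 1 =
      ω.meanEnergy (hubbardTTPrimeFermionInteraction 0 s U) 1 := by
  rw [InfVolFermionState.meanEnergy, InfVolFermionState.meanEnergy, InfVolFermionState.mapAct_expect,
    ← ω.compatible mapSet_checkerboard_thicken_one_subset, fermionEmbed_mapEmb_meanEnergyObs_checkerboard,
    ω.compatible]

/-- **EVERY NEAREST-NEIGHBOUR FLOOR IS A DIAGONAL-ONLY FLOOR**: for `U ≥ 0`, `0 < ρ < 2` and every real
`s`, `energyDensityTT' s 0 U ρ ≤ energyDensityTT' 0 s U ρ` — the energy density of the model with ONLY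
diagonal hopping `s` (and repulsion `U`) is at least that of the square-lattice Hubbard model with
nearest-neighbour hopping `s` (the pulled-back states `ω ∘ Γ_cb` of the translation-invariant states of
filling `ρ` form a subclass of them). With the conic transport lemma `energyDensityTT'_ge_sum_conic` this
turns every certified `t' = 0` row into an anchor on the `t = 0` plane WITH its `U`-content.
[cite: Ruelle1969, §3.4] -/
theorem energyDensityTT'_nn_le_diag (s : ℝ) {U : ℝ} (hU : 0 ≤ U) {ρ : ℝ} (hρ0 : 0 < ρ) (hρ2 : ρ < 2) :
    energyDensityTT' s 0 U ρ ≤ energyDensityTT' 0 s U ρ := by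
  rw [← tiGroundEnergyDensityAt_hubbardTTPrime_eq_energyDensityTT' 0 s hU hρ0 hρ2]
  refine FermionInteraction.le_tiGroundEnergyDensityAt _ 1 (exists_isTranslationInvariant_density_eq hρ0 hρ2)
    fun ω hω hρ => ?_
  rw [← ω.meanEnergy_mapAct_checkerboard s U]
  have hTI := hω.mapAct checkerboard checkerboard_injective
  have hρ' : (ω.mapAct checkerboard checkerboard_injective).density = ρ := by
    rw [ω.density_mapAct checkerboard checkerboard_injective (map_zero _), hρ]
  exact InfVolFermionState.energyDensityTT'_le_meanEnergy_of_isTranslationInvariant s 0 hU hρ0 hρ2 hTI hρ'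

end Checkerboard

end Literature.MathematicalPhysics.QuantumLattice

end
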